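import Summits.Langlands.Langlands.Theorems.IrreducibilityBySelfDualityVarmaWeilTracesUnramified
import Literature.NumberTheory.Automorphic.VarmaTheorem1BaseChangeProofs
import Literature.NumberTheory.Automorphic.VarmaCorollary93BaseChangeProofs
import Literature.NumberTheory.Automorphic.VarmaProp71TwoN
import HarnessLib

/-!
# `VarmaCorollary93Unramified` (stmt-Langlands-17013, route IrreducibilityBySelfDuality): Varma's
# Cor. 9.3 at the unramified places — status, residue and the unconditional cases

The item is the promoted named fact `Literature.NumberTheory.Automorphic.Varma2024.corollary93_unramified`
VERBATIM (binders fully qualified): for `K` totally real or CM, `π` cuspidal regular algebraic on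
`GL_n(𝔸_K)`, `ℓ`, `ι : ℚ̄_ℓ ≃ ℂ`, EVERY continuous semisimple `r : Γ_K → GL_n(ℚ̄_ℓ)` with
Harris–Lan–Taylor–Thorne's property `IsCompatible π ι r` (i.e. `r ≅ r_{ℓ,ι}(π)` by the uniqueness
clause of Thm. A, PROVED in the tree, `theoremA_uniqueness_holds`) is compatible with `π`
(`IsGaloisCompatibleAt`: unramified, arithmetic-Frobenius characteristic polynomial
`arithFrobPolyOfSatake ι q_v n α`) at every `v ∤ ℓ`.  Its content beyond Thm. A is Varma's Theorem 1
(Forum Math. Sigma 12 (2024) e21, p. 2) at the places `v ∤ ℓ` with `π_v` unramified but `π_w` ramified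
at another place `w` over the same rational prime; the printed proof (§§5–7: ordinary `p`-adic
automorphic forms on `U(n,n)` and the Bernstein centre, Prop. 7.1) is far outside the tree.

This file is STRUCTURAL (it does not import the Theses file; every theorem is stated on the item's
text, so that the gate's `_holds` link cannot close an import cycle) and records, sorry-free on the
standard axioms:

* `iff_corollary93_unramified` — the item's text IS the Literature fact (`Iff.rfl`), and
  `of_corollary93_unramified` — the conditional closer: the day `corollary93_unramified_holds` lands,
  `of_corollary93_unramified corollary93_unramified_holds` closes the item.
* `of_prop71`, `of_theorem92` — **the exact residue**: the item follows from the three apex named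
  facts `Varma2024.prop71_twoN` (Thm. 5.1 + Prop. 7.1, the `2n`-dimensional family on `U(n,n)`),
  `ArthurClozel1989_strongLifting_archimedean`, `ArthurClozel1989_strongLifting_cuspidal`, everything
  above Prop. 7.1 being proved in the tree (`theorem1_unramified_traces_of_prop71`,
  `corollary93_unramified_of_weilTraces`); or from Thm. 9.2 as a raw hypothesis with the same two
  Arthur–Clozel leaves (`corollary93_unramified_of_theorem92`).
* `of_theorem1_unramified_traces`, `of_exists_galoisRep_of_regularAlgebraic`,
  `iff_varmaWeilTracesUnramified` — one line from each of the other two existing named facts, and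
  **the item is equivalent to its sibling item `VarmaWeilTracesUnramified` (stmt-Langlands-15004)**:
  the two open Varma items of the route are ONE debt.
* The unconditional cases: `of_rank_le_one` (Weil 1956 + the proved uniqueness clause), `of_rat`
  (`K = ℚ`, every `n`: no rational prime has two places), `of_forall_place_eq` (an isolated place),
  `of_forall_ne_isUnramifiedAt` (every OTHER place over the same rational prime unramified for `π` —
  the only obstruction is ramification of `π` elsewhere over `q`), `eventually` (all but finitely
  many `v`).

References: I. Varma, Forum Math. Sigma 12 (2024) e21, Thm. 1 (p. 2), Prop. 7.1 (p. 20), Thm. 9.2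
(pp. 30–31), Cor. 9.3 (p. 32) [VarmaFMS2024]; M. Harris, K.-W. Lan, R. Taylor, J. Thorne, Res. Math.
Sci. 3:37 (2016), Thm. A (p. 3) [HarrisLanTaylorThorneRMS2016]; J. Arthur, L. Clozel, Ann. of Math.
Stud. 120 (1989), Ch. 3 Thm. 4.2, Thm. 5.1 [ArthurClozelAMS120]; A. Weil, *On a certain type of
characters of the idèle-class group of an algebraic number-field* (1956) [Weil1956].
-/

noncomputable section

set_option linter.dupNamespace false

open scoped MatrixGroups Matrix NumberField Polynomial Classical
open NumberField IsDedekindDomain Field Polynomial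
open Literature.NumberTheory.Automorphic Literature.NumberTheory.GaloisRepresentations
open Literature.NumberTheory.Automorphic.HarrisLanTaylorThorne2016

namespace Summit.Langlands.Langlands.Theorems.VarmaCorollary93Unramified

/-! ### The item is the Literature fact `Varma2024.corollary93_unramified`, verbatim -/

/-- **Kernel certificate**: the text of the item `VarmaCorollary93Unramified` (stmt-Langlands-17013,
written here exactly as in the route file, binders fully qualified) is definitionally — indeed
syntactically — the Literature named fact `Varma2024.corollary93_unramified` (`Iff.rfl`).
[cite: VarmaFMS2024, Thm. 1 (p. 2) and Cor. 9.3 (p. 32)] -/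
theorem iff_corollary93_unramified :
    (∀ {n : ℕ} {K : Type} [Field K] [NumberField K]
      (hcpt : Literature.NumberTheory.Automorphic.isCompact_glFiniteIntegralLevel n K),
      NumberField.IsTotallyReal K ∨ NumberField.IsCMField K →
      ∀ (π : Literature.NumberTheory.Automorphic.CuspidalAutomorphicRepData n K hcpt),
      π.1.IsRegularAlgebraic → ∀ (ℓ : ℕ) [Fact ℓ.Prime] (ι : PadicAlgCl ℓ ≃+* ℂ)
      (r : Literature.NumberTheory.GaloisRepresentations.FramedGaloisRep K (PadicAlgCl ℓ) n),
      r.toGaloisRep.IsSemisimple →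
      Literature.NumberTheory.Automorphic.HarrisLanTaylorThorne2016.IsCompatible π.1 ι r →
      ∀ v : IsDedekindDomain.HeightOneSpectrum (NumberField.RingOfIntegers K),
      ((ℓ : ℕ) : NumberField.RingOfIntegers K) ∉ v.asIdeal →
      Literature.NumberTheory.Automorphic.IsGaloisCompatibleAt π.1 ι r v) ↔
    Varma2024.corollary93_unramified :=
  Iff.rfl

/-- **The item from the Literature fact `Varma2024.corollary93_unramified` — the conditional closer.**
Text of the item verbatim (as in the route file); the proof is the identity.  The day
`Varma2024.corollary93_unramified_holds` lands, `of_corollary93_unramified corollary93_unramified_holds`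
closes stmt-Langlands-17013. [cite: VarmaFMS2024, Thm. 1 (p. 2) and Cor. 9.3 (p. 32)] -/
theorem of_corollary93_unramified (h93 : Varma2024.corollary93_unramified) :
    ∀ {n : ℕ} {K : Type} [Field K] [NumberField K]
      (hcpt : Literature.NumberTheory.Automorphic.isCompact_glFiniteIntegralLevel n K),
      NumberField.IsTotallyReal K ∨ NumberField.IsCMField K →
      ∀ (π : Literature.NumberTheory.Automorphic.CuspidalAutomorphicRepData n K hcpt),
      π.1.IsRegularAlgebraic → ∀ (ℓ : ℕ) [Fact ℓ.Prime] (ι : PadicAlgCl ℓ ≃+* ℂ)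
      (r : Literature.NumberTheory.GaloisRepresentations.FramedGaloisRep K (PadicAlgCl ℓ) n),
      r.toGaloisRep.IsSemisimple →
      Literature.NumberTheory.Automorphic.HarrisLanTaylorThorne2016.IsCompatible π.1 ι r →
      ∀ v : IsDedekindDomain.HeightOneSpectrum (NumberField.RingOfIntegers K),
      ((ℓ : ℕ) : NumberField.RingOfIntegers K) ∉ v.asIdeal →
      Literature.NumberTheory.Automorphic.IsGaloisCompatibleAt π.1 ι r v :=
  h93

/-! ### One line from the other two existing named facts; equivalence with the sibling item -/

/-- **The item from Varma's Theorem 1 in trace form** (`Varma2024.theorem1_unramified_traces`): the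
Weil traces in non-zero degree give back compatibility at `v` by the landed composition of line
`Sketch` (`GaloisRepOfRegularAlgebraic.corollary93_unramified_of_weilTraces`: Satake gap of a cuspidal
`π`, Grothendieck's monodromy theorem, local rigidity — all proved).
[cite: VarmaFMS2024, Thm. 1 (p. 2)] -/
theorem of_theorem1_unramified_traces (hV : Varma2024.theorem1_unramified_traces) :
    ∀ {n : ℕ} {K : Type} [Field K] [NumberField K] (hcpt : isCompact_glFiniteIntegralLevel n K),
      IsTotallyReal K ∨ IsCMField K →
      ∀ (π : CuspidalAutomorphicRepData n K hcpt), π.1.IsRegularAlgebraic →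
      ∀ (ℓ : ℕ) [Fact ℓ.Prime] (ι : PadicAlgCl ℓ ≃+* ℂ) (r : FramedGaloisRep K (PadicAlgCl ℓ) n),
        r.toGaloisRep.IsSemisimple → IsCompatible π.1 ι r →
        ∀ v : HeightOneSpectrum (𝓞 K), ((ℓ : ℕ) : 𝓞 K) ∉ v.asIdeal →
          IsGaloisCompatibleAt π.1 ι r v :=
  GaloisRepOfRegularAlgebraic.corollary93_unramified_of_weilTraces
    fun hcpt hK π hπ ℓ _ ι r hr hc v hv α hα σ d _ hσ => hV hcpt hK π hπ ℓ ι r hr hc v hv α hα σ d hσ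

/-- **The item from lang.S27** (`exists_galoisRep_of_regularAlgebraic`, the named fact behind the
parent crux `GaloisRepOfRegularAlgebraic`, stmt-Langlands-10785): by the proved uniqueness clause of
Thm. A (`Varma2024.corollary93_unramified_of_regularAlgebraic`).
[cite: HarrisLanTaylorThorneRMS2016, Thm. A (p. 3), uniqueness clause] [cite: VarmaFMS2024, Cor. 9.3 (p. 32)] -/
theorem of_exists_galoisRep_of_regularAlgebraic (hS : exists_galoisRep_of_regularAlgebraic) :
    ∀ {n : ℕ} {K : Type} [Field K] [NumberField K] (hcpt : isCompact_glFiniteIntegralLevel n K),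
      IsTotallyReal K ∨ IsCMField K →
      ∀ (π : CuspidalAutomorphicRepData n K hcpt), π.1.IsRegularAlgebraic →
      ∀ (ℓ : ℕ) [Fact ℓ.Prime] (ι : PadicAlgCl ℓ ≃+* ℂ) (r : FramedGaloisRep K (PadicAlgCl ℓ) n),
        r.toGaloisRep.IsSemisimple → IsCompatible π.1 ι r →
        ∀ v : HeightOneSpectrum (𝓞 K), ((ℓ : ℕ) : 𝓞 K) ∉ v.asIdeal →
          IsGaloisCompatibleAt π.1 ι r v :=
  Varma2024.corollary93_unramified_of_regularAlgebraic hS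

/-- **The two open Varma items of the route are one debt**: the text of `VarmaCorollary93Unramified`
(stmt-Langlands-17013) is equivalent in the tree to the text of `VarmaWeilTracesUnramified`
(stmt-Langlands-15004, Thm. 1 in trace form, non-zero degree) — forward by the Weil traces of a
compatible representation (`VarmaWeilTracesUnramified.of_corollary93_unramified`), backward by the
landed composition of line `Sketch` (`VarmaWeilTracesUnramified.iff_corollary93_unramified`).
[cite: VarmaFMS2024, Thm. 1 (p. 2) and Cor. 9.3 (p. 32)] -/
theorem iff_varmaWeilTracesUnramified :
    (∀ {n : ℕ} {K : Type} [Field K] [NumberField K] (hcpt : isCompact_glFiniteIntegralLevel n K),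
      IsTotallyReal K ∨ IsCMField K →
      ∀ (π : CuspidalAutomorphicRepData n K hcpt), π.1.IsRegularAlgebraic →
      ∀ (ℓ : ℕ) [Fact ℓ.Prime] (ι : PadicAlgCl ℓ ≃+* ℂ) (r : FramedGaloisRep K (PadicAlgCl ℓ) n),
        r.toGaloisRep.IsSemisimple → IsCompatible π.1 ι r →
        ∀ v : HeightOneSpectrum (𝓞 K), ((ℓ : ℕ) : 𝓞 K) ∉ v.asIdeal →
          IsGaloisCompatibleAt π.1 ι r v) ↔
    (∀ {n : ℕ} {K : Type} [Field K] [NumberField K] (hcpt : isCompact_glFiniteIntegralLevel n K),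
      IsTotallyReal K ∨ IsCMField K →
      ∀ (π : CuspidalAutomorphicRepData n K hcpt), π.1.IsRegularAlgebraic →
      ∀ (ℓ : ℕ) [Fact ℓ.Prime] (ι : PadicAlgCl ℓ ≃+* ℂ) (r : FramedGaloisRep K (PadicAlgCl ℓ) n),
        r.toGaloisRep.IsSemisimple → IsCompatible π.1 ι r →
        ∀ (v : HeightOneSpectrum (𝓞 K)), ((ℓ : ℕ) : 𝓞 K) ∉ v.asIdeal →
        ∀ (α : Multiset ℂ), π.1.HasSatakeParamAt v α →
        ∀ (σ : absoluteGaloisGroup (v.adicCompletion K)) (d : ℤ), d ≠ 0 → IsFrobPow σ d →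
          (((r.toLocal v) σ : GL (Fin n) (PadicAlgCl ℓ)) : Matrix (Fin n) (Fin n) (PadicAlgCl ℓ)).trace
            = ((arithFrobPolyOfSatake ι v.residueCard n α).roots.map fun b => b ^ d).sum) :=
  VarmaWeilTracesUnramified.iff_corollary93_unramified.symm

/-! ### The exact residue: the three apex leaves -/

/-- **The item from the three apex named facts, everything above Varma's Prop. 7.1 being proved in
the tree.**  Granted `Varma2024.prop71_twoN` (Thm. 5.1 + Prop. 7.1 with HLTT Cor. 6.27: the
`2n`-dimensional family `R_p(π, N)` on `U(n,n)`, XL apex) and the two Arthur–Clozel leaves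
(`ArthurClozel1989_strongLifting_archimedean`, `ArthurClozel1989_strongLifting_cuspidal`), the tree
proves Thm. 1 at the unramified places in trace form (`Varma2024.theorem1_unramified_traces_of_prop71`:
Prop. 9.1, Thm. 9.2 with (9.1), quadratic base change and descent as in Harris–Taylor VII.1.9), whence
the item (`of_theorem1_unramified_traces`).  So the residue of stmt-Langlands-17013 is exactly
`{prop71_twoN, ArthurClozel1989_strongLifting_archimedean, ArthurClozel1989_strongLifting_cuspidal}`.
[cite: VarmaFMS2024, Thm. 5.1 (p. 16), Prop. 7.1 (p. 20), Thm. 9.2 (pp. 30–31), Cor. 9.3 (p. 32)]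
[cite: ArthurClozelAMS120, Ch. 3 Thm. 4.2 and Thm. 5.1] -/
theorem of_prop71 (h57 : Varma2024.prop71_twoN) (harch : ArthurClozel1989_strongLifting_archimedean)
    (hBC : ArthurClozel1989_strongLifting_cuspidal) :
    ∀ {n : ℕ} {K : Type} [Field K] [NumberField K] (hcpt : isCompact_glFiniteIntegralLevel n K),
      IsTotallyReal K ∨ IsCMField K →
      ∀ (π : CuspidalAutomorphicRepData n K hcpt), π.1.IsRegularAlgebraic →
      ∀ (ℓ : ℕ) [Fact ℓ.Prime] (ι : PadicAlgCl ℓ ≃+* ℂ) (r : FramedGaloisRep K (PadicAlgCl ℓ) n),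
        r.toGaloisRep.IsSemisimple → IsCompatible π.1 ι r →
        ∀ v : HeightOneSpectrum (𝓞 K), ((ℓ : ℕ) : 𝓞 K) ∉ v.asIdeal →
          IsGaloisCompatibleAt π.1 ι r v :=
  of_theorem1_unramified_traces (Varma2024.theorem1_unramified_traces_of_prop71 h57 harch hBC)

/-- **The item from Varma's Thm. 9.2 (raw hypothesis, unramified-place form) and the two Arthur–Clozel
leaves** — the printed "Theorem 9.2 in conjunction with Lemma 1 of [So] using the same argument as in
Theorem VII.1.9 of [HT]", proved in the tree as `Varma2024.corollary93_unramified_of_theorem92`.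
[cite: VarmaFMS2024, Thm. 9.2 (pp. 30–31), Cor. 9.3 (p. 32) and its proof] -/
theorem of_theorem92
    (h92 : ∀ {n : ℕ} {K : Type} [Field K] [NumberField K]
      (hcpt : isCompact_glFiniteIntegralLevel n K) (p : ℕ) [Fact p.Prime], 1 < n → IsCMField K →
      ∀ (F₀ : IntermediateField ℚ K), Module.finrank ℚ F₀ = 2 ∧ IsTotallyComplex F₀ →
      HasTwoPrimesOver F₀ p → (Module.finrank ℚ K = 2 → 2 < n) →
      ∀ (π : CuspidalAutomorphicRepData n K hcpt), π.1.IsRegularAlgebraic →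
      ∀ (ι : PadicAlgCl p ≃+* ℂ),
      ∃ r : FramedGaloisRep K (PadicAlgCl p) n, r.toGaloisRep.IsSemisimple ∧
        ∀ q : ℕ, q.Prime → q ≠ p →
          (HasTwoPrimesOver F₀ q ∨
            (Algebra.IsUnramifiedIn (𝓞 K) (Ideal.span {(q : ℤ)}) ∧ π.1.IsUnramifiedAbove q)) →
          ∀ v : HeightOneSpectrum (𝓞 K), ((q : ℕ) : 𝓞 K) ∈ v.asIdeal →
            IsGaloisCompatibleAt π.1 ι r v)
    (harch : ArthurClozel1989_strongLifting_archimedean)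
    (hBC : ArthurClozel1989_strongLifting_cuspidal) :
    ∀ {n : ℕ} {K : Type} [Field K] [NumberField K] (hcpt : isCompact_glFiniteIntegralLevel n K),
      IsTotallyReal K ∨ IsCMField K →
      ∀ (π : CuspidalAutomorphicRepData n K hcpt), π.1.IsRegularAlgebraic →
      ∀ (ℓ : ℕ) [Fact ℓ.Prime] (ι : PadicAlgCl ℓ ≃+* ℂ) (r : FramedGaloisRep K (PadicAlgCl ℓ) n),
        r.toGaloisRep.IsSemisimple → IsCompatible π.1 ι r →
        ∀ v : HeightOneSpectrum (𝓞 K), ((ℓ : ℕ) : 𝓞 K) ∉ v.asIdeal →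
          IsGaloisCompatibleAt π.1 ι r v :=
  Varma2024.corollary93_unramified_of_theorem92 h92 harch hBC

/-! ### The unconditional cases -/

/-- **Ranks `n ≤ 1`, unconditionally** (Weil 1956 via the landed
`GaloisRepOfRegularAlgebraic.of_rank_le_one`, the proved uniqueness clause of Thm. A and the
isomorphism invariance of compatibility; `VarmaWeilTracesUnramified.isGaloisCompatibleAt_of_rank_le_one`).
[cite: Weil1956, §1–§2] [cite: HarrisLanTaylorThorneRMS2016, Thm. A (p. 3), uniqueness clause] -/
theorem of_rank_le_one :
    ∀ {n : ℕ}, n ≤ 1 → ∀ {K : Type} [Field K] [NumberField K]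
      (hcpt : isCompact_glFiniteIntegralLevel n K),
      IsTotallyReal K ∨ IsCMField K →
      ∀ (π : CuspidalAutomorphicRepData n K hcpt), π.1.IsRegularAlgebraic →
      ∀ (ℓ : ℕ) [Fact ℓ.Prime] (ι : PadicAlgCl ℓ ≃+* ℂ) (r : FramedGaloisRep K (PadicAlgCl ℓ) n),
        r.toGaloisRep.IsSemisimple → IsCompatible π.1 ι r →
        ∀ v : HeightOneSpectrum (𝓞 K), ((ℓ : ℕ) : 𝓞 K) ∉ v.asIdeal →
          IsGaloisCompatibleAt π.1 ι r v :=
  fun hn _ _ _ hcpt hK π hπ ℓ _ ι r hr hc v hv =>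
    VarmaWeilTracesUnramified.isGaloisCompatibleAt_of_rank_le_one hn hcpt hK π hπ ℓ ι r hr hc v hv

/-- **`K = ℚ`, every rank, unconditionally** (indeed for ANY `π` and any HLTT-compatible `r`, the
hypotheses "`ℚ` totally real", "`π` cuspidal regular algebraic", "`r` semisimple" being idle): over
`ℚ` every rational prime has exactly one place above it, so "`π_p` unramified" is "`π` unramified
above `p`" and Thm. A answers (`Varma2024.corollary93_unramified_rat`).  The item's text with
`K := ℚ`. [cite: HarrisLanTaylorThorneRMS2016, Thm. A (p. 3)] -/
theorem of_rat :
    ∀ {n : ℕ} (hcpt : isCompact_glFiniteIntegralLevel n ℚ),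
      IsTotallyReal ℚ ∨ IsCMField ℚ →
      ∀ (π : CuspidalAutomorphicRepData n ℚ hcpt), π.1.IsRegularAlgebraic →
      ∀ (ℓ : ℕ) [Fact ℓ.Prime] (ι : PadicAlgCl ℓ ≃+* ℂ) (r : FramedGaloisRep ℚ (PadicAlgCl ℓ) n),
        r.toGaloisRep.IsSemisimple → IsCompatible π.1 ι r →
        ∀ v : HeightOneSpectrum (𝓞 ℚ), ((ℓ : ℕ) : 𝓞 ℚ) ∉ v.asIdeal →
          IsGaloisCompatibleAt π.1 ι r v :=
  fun _ _ _ _ _ _ _ _ _ hc v hv => Varma2024.corollary93_unramified_rat hc v hv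

/-- **An isolated place, unconditionally**: for any number field `K`, any `π` and any HLTT-compatible
`r`, at a place `v ∤ ℓ` which is the ONLY place of `K` over its rational prime (e.g. inert or totally
ramified), compatibility holds (`IsCompatible.isGaloisCompatibleAt_of_forall_eq`): there is no other
place over `q` at which `π` could ramify. [cite: HarrisLanTaylorThorneRMS2016, Thm. A (p. 3)] -/
theorem of_forall_place_eq {n : ℕ} {K : Type} [Field K] [NumberField K]
    {hcpt : isCompact_glFiniteIntegralLevel n K} {ℓ : ℕ} [Fact ℓ.Prime]
    (π : AutomorphicRepData (AutomorphyDatum.gl n K hcpt)) (ι : PadicAlgCl ℓ ≃+* ℂ)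
    (r : FramedGaloisRep K (PadicAlgCl ℓ) n) (hc : IsCompatible π ι r)
    (v : HeightOneSpectrum (𝓞 K)) (hv : ((ℓ : ℕ) : 𝓞 K) ∉ v.asIdeal)
    (huniq : ∀ q : ℕ, q.Prime → ((q : ℕ) : 𝓞 K) ∈ v.asIdeal →
      ∀ w : HeightOneSpectrum (𝓞 K), ((q : ℕ) : 𝓞 K) ∈ w.asIdeal → w = v) :
    IsGaloisCompatibleAt π ι r v :=
  hc.isGaloisCompatibleAt_of_forall_eq hv huniq

/-- **The only obstruction is ramification of `π` at ANOTHER place over the same rational prime.**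
For any `K`, `π`, and HLTT-compatible `r`: if `π` is unramified at every place `w ≠ v` lying over a
rational prime below `v`, then `r` is compatible with `π` at `v ∤ ℓ` — either `π` is ramified at `v`
(and compatibility at `v` is vacuous) or `π` is unramified above `q` and Thm. A answers.  What the
item adds to this is precisely Varma's Theorem 1: the places `v` with `π_v` unramified and `π_w`
ramified for some `w ≠ v` over the same `q`. [cite: HarrisLanTaylorThorneRMS2016, Thm. A (p. 3)]
[cite: VarmaFMS2024, Thm. 1 (p. 2)] -/
theorem of_forall_ne_isUnramifiedAt {n : ℕ} {K : Type} [Field K] [NumberField K]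
    {hcpt : isCompact_glFiniteIntegralLevel n K} {ℓ : ℕ} [Fact ℓ.Prime]
    (π : AutomorphicRepData (AutomorphyDatum.gl n K hcpt)) (ι : PadicAlgCl ℓ ≃+* ℂ)
    (r : FramedGaloisRep K (PadicAlgCl ℓ) n) (hc : IsCompatible π ι r)
    (v : HeightOneSpectrum (𝓞 K)) (hv : ((ℓ : ℕ) : 𝓞 K) ∉ v.asIdeal)
    (hothers : ∀ q : ℕ, q.Prime → ((q : ℕ) : 𝓞 K) ∈ v.asIdeal →
      ∀ w : HeightOneSpectrum (𝓞 K), w ≠ v → ((q : ℕ) : 𝓞 K) ∈ w.asIdeal → π.IsUnramifiedAt w) :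
    IsGaloisCompatibleAt π ι r v := by
  intro α hα
  obtain ⟨q, hq, hqv⟩ := exists_natPrime_natCast_mem v
  have hqℓ : q ≠ ℓ := by
    rintro rfl
    exact hv hqv
  have hπq : π.IsUnramifiedAbove q := fun w hw => by
    by_cases hwv : w = v
    · subst hwv
      exact ⟨α, hα⟩
    · exact hothers q hq hqv w hwv hw
  exact hc q hq hqℓ hπq v hqv α hα

/-- **The item at all but finitely many places, unconditionally**: for any `K`, `π` and
HLTT-compatible `r`, compatibility holds at every `v` outside a finite set (the places over `ℓ` and
over the rational primes below the finitely many ramified places of `π` — Flath,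
`hasSatakeParamAt_cofinite_holds`; `GaloisRepOfRegularAlgebraic.eventually_isGaloisCompatibleAt_of_isCompatible`).
[cite: HarrisLanTaylorThorneRMS2016, Thm. A (p. 3)] -/
theorem eventually {n : ℕ} {K : Type} [Field K] [NumberField K]
    {hcpt : isCompact_glFiniteIntegralLevel n K} {ℓ : ℕ} [Fact ℓ.Prime]
    (π : AutomorphicRepData (AutomorphyDatum.gl n K hcpt)) (ι : PadicAlgCl ℓ ≃+* ℂ)
    (r : FramedGaloisRep K (PadicAlgCl ℓ) n) (hc : IsCompatible π ι r) :
    ∀ᶠ v : HeightOneSpectrum (𝓞 K) in Filter.cofinite, IsGaloisCompatibleAt π ι r v :=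
  GaloisRepOfRegularAlgebraic.eventually_isGaloisCompatibleAt_of_isCompatible π ι r hc

end Summit.Langlands.Langlands.Theorems.VarmaCorollary93Unramified

end
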